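import Summits.AnomalousDissipation.AnomalousDissipation.Theorems.MarginalStabilityChainStrainedLayerLawClockCirculationDensityLaw
import Summits.AnomalousDissipation.AnomalousDissipation.Theorems.MarginalStabilityChainStrainedLayerLawClockSteadyExactLaws
import HarnessLib

/-!
# Crux `MarginalStabilityChain.StrainedLayerLaw` (stmt-AnomalousDissipation-3007), line `FirstLemmasR2K4`
# (log-enstrophy clock + Nash roundness): the column flux of a STEADY tailed member is constant

Support file (`--supports stmt-AnomalousDissipation-3007`; registered sub-goal `steady_fluxConstant` of line
`FirstLemmasR2K4`, lead c7).

What it proves: along every classical solution `(u, v, p)` of the stretched two-dimensional Navier–Stokes layer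
class on `(0, ∞)` (`ν, L > 0`, normalisation `γ = ΔU = 1`) with shear tails on every compact time interval which
is moreover STEADY (`u s = u t`, `v s = v t` for all `s, t > 0`), the column flux
`G(x) = ∫_y uv − ν ∫_y ω = Π(x) + νγ(x)` (`ω = ∂ₓv − ∂_yu`, `γ = −∫_y ω`, `Π = ∫_y uv`) does not depend on `x`:
the strong (integrated) form `Π + νγ ≡ const` of the steady circulation-density law `∂ₓₓ(Π + νγ) = ∂ₜγ = 0`.

Route: the landed weak law `circulationDensity_weak_law` on the window `[t/2, t]` has vanishing left side and a
time-constant integrand for a steady member (`steadyExactLaws_const_of_balance`), whence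
`∫_{x ∈ (0,L]} φ″(x) G(x) dx = 0` for every `L`-periodic `φ ∈ C²` (the factor `φ″(x)` leaves the inner
`y`-integrals by linearity). `G` is continuous (dominated convergence across the layer with the exponential tails)
and `L`-periodic, and the du Bois-Reymond lemma on the circle (`steadyFlux_duBoisReymond_periodic`: test against the
periodic `C²` double primitive `φ` of `G − mean(G)`, so that `∫ (G − mean)² = 0`) makes `G` constant.
All `[folklore]` (steady `x`-moment bookkeeping of 2-D vorticity dynamics in a strain, e.g. Majda–Bertozzi,
*Vorticity and Incompressible Flow*, CUP 2002, §1.4; du Bois-Reymond's lemma, e.g. Giaquinta–Hildebrandt,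
*Calculus of Variations I*, Springer 1996, Ch. 1, §2.3). No facts are asserted.
-/

-- `Summit.<Summit>.<Problem>` is the tree's mandated summit-side namespace (CONVENTIONS §2); for this
-- single-conjunct summit the two coincide, so the duplicate is deliberate.
set_option linter.dupNamespace false

noncomputable section

open scoped Topology ENNReal
open Filter Set Function MeasureTheory

namespace Summit.AnomalousDissipation.AnomalousDissipation.Theorems.StrainedLayerLaw.LogEnstrophyClock

open Literature.Analysis.FluidPDE Literature.Analysis.FluidPDE.StretchedLayer
open Summit.AnomalousDissipation.AnomalousDissipation.Theses.MarginalStabilityChain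
open Summit.AnomalousDissipation.AnomalousDissipation.Theorems.StrainedLayerLaw.StrainWorkSumRule

/-! ## Du Bois-Reymond's lemma on the circle -/

section DuBoisReymond

/-- **A periodic primitive.** For a continuous `L`-periodic `h` with `∫_0^L h = 0`, the primitive `x ↦ ∫_0^x h` has
derivative `h` everywhere, is continuous and is `L`-periodic. [folklore] -/
theorem steadyFlux_primitive_periodic {h : ℝ → ℝ} {L : ℝ} (ch : Continuous h) (hper : ∀ x, h (x + L) = h x)
    (h0 : ∫ x in 0..L, h x = 0) :
    (∀ x, HasDerivAt (fun z => ∫ s in 0..z, h s) (h x) x) ∧ Continuous (fun z => ∫ s in 0..z, h s) ∧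
      ∀ x, (∫ s in 0..x + L, h s) = ∫ s in 0..x, h s := by
  have hd : ∀ x, HasDerivAt (fun z => ∫ s in 0..z, h s) (h x) x := fun x =>
    (ch.integral_hasStrictDerivAt 0 x).hasDerivAt
  refine ⟨hd, continuous_iff_continuousAt.2 fun x => (hd x).continuousAt, fun x => ?_⟩
  have hp : Periodic h L := hper
  rw [← intervalIntegral.integral_add_adjacent_intervals (ch.intervalIntegrable 0 x)
    (ch.intervalIntegrable x (x + L)), hp.intervalIntegral_add_eq x 0, zero_add, h0, add_zero]

/-- **Du Bois-Reymond's lemma on the circle (second-order form).** A continuous `L`-periodic function `G` (`L > 0`)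
with `∫_{(0,L]} φ″G = 0` for every `L`-periodic `φ ∈ C²` is constant: test against the periodic `C²` double
primitive of `G − Ḡ` (`Ḡ` = the mean), which gives `∫_0^L (G − Ḡ)² = 0`. [folklore] -/
theorem steadyFlux_duBoisReymond_periodic {G : ℝ → ℝ} {L : ℝ} (hL : 0 < L) (hG : Continuous G)
    (hper : ∀ x, G (x + L) = G x)
    (hweak : ∀ φ : ℝ → ℝ, ContDiff ℝ 2 φ → (∀ x, φ (x + L) = φ x) →
      ∫ x in Ioc 0 L, deriv (deriv φ) x * G x = 0) (x₁ x₂ : ℝ) : G x₁ = G x₂ := by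
  have hL0 : L ≠ 0 := hL.ne'
  -- the centred function `h = G − Ḡ`
  set m : ℝ := L⁻¹ * ∫ x in 0..L, G x with hm
  set h : ℝ → ℝ := fun x => G x - m with hh
  have ch : Continuous h := hG.sub continuous_const
  have ph : ∀ x, h (x + L) = h x := fun x => by simp only [hh, hper]
  have ih : ∫ x in 0..L, h x = 0 := by
    simp only [hh]
    rw [intervalIntegral.integral_sub (hG.intervalIntegrable 0 L) intervalIntegrable_const,
      intervalIntegral.integral_const, smul_eq_mul, sub_zero, hm, ← mul_assoc, mul_inv_cancel₀ hL0, one_mul, sub_self]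
  -- the first primitive `φ₁` and the recentred `φ₁ + c`
  obtain ⟨dφ₁, cφ₁, pφ₁⟩ := steadyFlux_primitive_periodic ch ph ih
  set φ₁ : ℝ → ℝ := fun z => ∫ s in 0..z, h s with hφ₁
  set c : ℝ := -(L⁻¹ * ∫ x in 0..L, φ₁ x) with hc
  have cψ : Continuous fun x => φ₁ x + c := cφ₁.add continuous_const
  have pψ : ∀ x, φ₁ (x + L) + c = φ₁ x + c := fun x => by
    show (∫ s in 0..x + L, h s) + c = (∫ s in 0..x, h s) + c
    rw [pφ₁ x]
  have iψ : ∫ x in 0..L, (φ₁ x + c) = 0 := by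
    rw [intervalIntegral.integral_add (cφ₁.intervalIntegrable 0 L) intervalIntegrable_const,
      intervalIntegral.integral_const, smul_eq_mul, sub_zero, hc, mul_neg, ← mul_assoc, mul_inv_cancel₀ hL0, one_mul,
      add_neg_cancel]
  -- the second primitive `φ`
  obtain ⟨dφ, -, pφ⟩ := steadyFlux_primitive_periodic cψ pψ iψ
  set φ : ℝ → ℝ := fun z => ∫ s in 0..z, (φ₁ s + c) with hφ
  have e1 : deriv φ = fun x => φ₁ x + c := funext fun x => (dφ x).deriv
  have e2 : deriv (fun x => φ₁ x + c) = h := funext fun x => ((dφ₁ x).add_const c).deriv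
  have hC1 : ContDiff ℝ 1 (fun x => φ₁ x + c) := by
    rw [contDiff_one_iff_deriv, e2]
    exact ⟨fun x => ((dφ₁ x).add_const c).differentiableAt, ch⟩
  have hC2 : ContDiff ℝ 2 φ := by
    rw [show (2 : WithTop ℕ∞) = 1 + 1 from rfl, contDiff_succ_iff_deriv, e1]
    exact ⟨fun x => (dφ x).differentiableAt, by simp, hC1⟩
  -- test the weak identity against `φ`: `∫_{(0,L]} hG = 0`, i.e. `∫_0^L h² = 0`
  have key := hweak φ hC2 pφ
  rw [e1, e2, ← intervalIntegral.integral_of_le hL.le] at key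
  have hsq : ∫ x in 0..L, h x ^ 2 = 0 := by
    have e : (fun x => h x * G x) = fun x => h x ^ 2 + m * h x := funext fun x => by simp only [hh]; ring
    have ch2 : Continuous fun x => h x ^ 2 := ch.pow 2
    have chm : Continuous fun x => m * h x := continuous_const.mul ch
    rw [e, intervalIntegral.integral_add (ch2.intervalIntegrable 0 L) (chm.intervalIntegrable 0 L),
      intervalIntegral.integral_const_mul, ih, mul_zero, add_zero] at key
    exact key
  -- hence `h = 0` on `[0, L]`
  have hz : ∀ x ∈ Icc 0 L, h x = 0 := by
    by_contra hne
    push Not at hne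
    obtain ⟨x₀, hx₀, hx₀'⟩ := hne
    have hlt := intervalIntegral.integral_lt_integral_of_continuousOn_of_le_of_exists_lt (f := fun _ => (0:ℝ))
      (g := fun x => h x ^ 2) hL continuousOn_const (ch.pow 2).continuousOn (fun x _ => sq_nonneg (h x))
      ⟨x₀, hx₀, by positivity⟩
    rw [intervalIntegral.integral_zero, hsq] at hlt
    exact lt_irrefl _ hlt
  -- and `G = Ḡ` everywhere by periodicity
  have hGm : ∀ x ∈ Icc 0 L, G x = m := fun x hx => by
    have h1 := hz x hx
    simp only [hh] at h1
    linarith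
  have hp : Periodic G L := hper
  obtain ⟨y₁, hy₁, ey₁⟩ := hp.exists_mem_Ico₀ hL x₁
  obtain ⟨y₂, hy₂, ey₂⟩ := hp.exists_mem_Ico₀ hL x₂
  rw [ey₁, ey₂, hGm y₁ (Ico_subset_Icc_self hy₁), hGm y₂ (Ico_subset_Icc_self hy₂)]

end DuBoisReymond

/-! ## Continuity of column integrals across the layer -/

section Column

/-- **Continuity of a column integral.** For a continuous plane field `F` with `|F(x, y)| ≤ Ce^{−k|y|}` (`k > 0`),
`x ↦ ∫_y F(x, y)` is continuous (dominated convergence). [folklore] -/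
theorem steadyFlux_continuous_column {F : ℝ → ℝ → ℝ} {C k : ℝ} (hk : 0 < k)
    (hF : Continuous fun q : ℝ × ℝ => F q.1 q.2) (hC : 0 ≤ C) (hb : ∀ x y, |F x y| ≤ C * Real.exp (-k * |y|)) :
    Continuous fun x => ∫ y, F x y := by
  refine continuous_of_dominated (bound := fun y => C * Real.exp (-k * |y|))
    (fun x => (continuous_slice_y hF x).aestronglyMeasurable)
    (fun x => Eventually.of_forall fun y => by rw [Real.norm_eq_abs]; exact hb x y) ?_
    (Eventually.of_forall fun y => continuous_slice_x hF y)
  exact integrable_slice_of_abs_le_exp (F := fun y => C * Real.exp (-k * |y|)) (by fun_prop) hk fun y => by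
    rw [abs_of_nonneg (by positivity)]

end Column

/-! ## The registered sub-goal -/

/-- **THE COLUMN FLUX OF A STEADY TAILED MEMBER IS CONSTANT (registered sub-goal `steady_fluxConstant` of line
`FirstLemmasR2K4`).** Along every STEADY classical solution of the stretched layer class on `(0, ∞)` (`ν, L > 0`)
with shear tails on compact time intervals, at every `t > 0` the column flux `G(x) = ∫_y uv − ν∫_y ω = Π + νγ` is
independent of `x`: the weak circulation-density law `circulationDensity_weak_law` with a time-constant integrand gives
`∫_{(0,L]} φ″G = 0` for every `L`-periodic `φ ∈ C²`, `G` is continuous and `L`-periodic, and du Bois-Reymond's lemma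
on the circle applies. [folklore] -/
theorem steady_fluxConstant : ∀ (ν L : ℝ), 0 < ν → 0 < L → ∀ (u v p : ℝ → ℝ → ℝ → ℝ), IsStretchedLayerNSSolutionOn (Ioi 0) ν 1 1 L u v p → (∀ a b : ℝ, 0 < a → a < b → ExpTails (Icc a b) u v) → (∀ s t x y : ℝ, 0 < s → 0 < t → u s x y = u t x y ∧ v s x y = v t x y) → ∀ t : ℝ, 0 < t → ∀ x₁ x₂ : ℝ, (∫ y, u t x₁ y * v t x₁ y) - ν * (∫ y, vorticity (u t) (v t) x₁ y) = (∫ y, u t x₂ y * v t x₂ y) - ν * (∫ y, vorticity (u t) (v t) x₂ y) := by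
  intro ν L hν hL u v p hsol htails hsteady t ht x₁ x₂
  -- the window `[t/2, t]` and steadiness as equalities of slices
  set s : ℝ := t / 2 with hs_def
  have hs : 0 < s := by positivity
  have hst : s < t := by rw [hs_def]; linarith
  have hu : ∀ τ : ℝ, 0 < τ → u τ = u t := fun τ hτ =>
    funext fun x => funext fun y => (hsteady τ t x y hτ ht).1
  have hv : ∀ τ : ℝ, 0 < τ → v τ = v t := fun τ hτ =>
    funext fun x => funext fun y => (hsteady τ t x y hτ ht).2
  have hpos : ∀ τ ∈ Icc s t, 0 < τ := fun τ hτ => hs.trans_le hτ.1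
  have ht' : t ∈ Ioi (0:ℝ) := ht
  -- tails, regularity and periodicity of the slice at time `t`
  obtain ⟨C, k, hk, hCk⟩ := htails s t hs hst
  have hT : SliceTails C k (u t) (v t) := (hCk t ⟨hst.le, le_rfl⟩).1
  have hC : 0 ≤ C := hT.nonneg
  have hf2 : ContDiff ℝ 2 (fun q : ℝ × ℝ => u t q.1 q.2) := hsol.contDiff_u ht'
  have hg2 : ContDiff ℝ 2 (fun q : ℝ × ℝ => v t q.1 q.2) := hsol.contDiff_v ht'
  have cω : Continuous fun q : ℝ × ℝ => vorticity (u t) (v t) q.1 q.2 := (contDiff_one_vorticity hf2 hg2).continuous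
  have cuv : Continuous fun q : ℝ × ℝ => u t q.1 q.2 * v t q.1 q.2 := hf2.continuous.mul hg2.continuous
  have bω : ∀ x y, |vorticity (u t) (v t) x y| ≤ C * Real.exp (-k * |y|) := tails_abs_vorticity_le hT
  have buv : ∀ x y, |u t x y * v t x y| ≤ (1 + C) * C * Real.exp (-k * |y|) := fun x y =>
    circLaw_abs_mul_le (hT.abs_u_le hk x y) (hT.abs_v_le x y)
  have cP : Continuous fun x => ∫ y, u t x y * v t x y :=
    steadyFlux_continuous_column (F := fun x y => u t x y * v t x y) hk cuv (by positivity) buv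
  have cΩ : Continuous fun x => ∫ y, vorticity (u t) (v t) x y :=
    steadyFlux_continuous_column (F := fun x y => vorticity (u t) (v t) x y) hk cω hC bω
  have pP : ∀ x, (∫ y, u t (x + L) y * v t (x + L) y) = ∫ y, u t x y * v t x y := fun x => by
    simp only [hsol.periodic_u t ht', hsol.periodic_v t ht']
  have pΩ : ∀ x, (∫ y, vorticity (u t) (v t) (x + L) y) = ∫ y, vorticity (u t) (v t) x y := fun x => by
    simp only [StrainWorkSumRule.vorticity, dX_periodic (hsol.periodic_v t ht'), dY_periodic (hsol.periodic_u t ht')]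
  -- the column flux `G`
  set G : ℝ → ℝ := fun x => (∫ y, u t x y * v t x y) - ν * ∫ y, vorticity (u t) (v t) x y with hG
  have cG : Continuous G := cP.sub (continuous_const.mul cΩ)
  have pG : ∀ x, G (x + L) = G x := fun x => by simp only [hG, pP, pΩ]
  -- the weak law with a time-constant integrand: `∫_{(0,L]} φ″G = 0` for every periodic `φ ∈ C²`
  have hweak : ∀ φ : ℝ → ℝ, ContDiff ℝ 2 φ → (∀ x, φ (x + L) = φ x) →
      ∫ x in Ioc 0 L, deriv (deriv φ) x * G x = 0 := by
    intro φ hφ hφper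
    obtain ⟨-, -, -, cφ'', -⟩ := circLaw_testFunction hL hφ hφper
    have hbal := circulationDensity_weak_law ν L hν hL u v p hsol htails φ hφ hφper s t hs hst.le
    have h0 := steadyExactLaws_const_of_balance
      (g := fun τ => ν * (∫ x in Ioc 0 L, ∫ y, deriv (deriv φ) x * vorticity (u τ) (v τ) x y) -
        ∫ x in Ioc 0 L, ∫ y, deriv (deriv φ) x * (u τ x y * v τ x y))
      (c := ν * (∫ x in Ioc 0 L, ∫ y, deriv (deriv φ) x * vorticity (u t) (v t) x y) -
        ∫ x in Ioc 0 L, ∫ y, deriv (deriv φ) x * (u t x y * v t x y))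
      hst (by rw [hu s hs, hv s hs]) hbal (fun τ hτ => by simp only [hu τ (hpos τ hτ), hv τ (hpos τ hτ)])
    have e1 : (∫ x in Ioc 0 L, ∫ y, deriv (deriv φ) x * vorticity (u t) (v t) x y) =
        ∫ x in Ioc 0 L, deriv (deriv φ) x * ∫ y, vorticity (u t) (v t) x y :=
      setIntegral_congr_fun measurableSet_Ioc fun x _ => integral_const_mul _ _
    have e2 : (∫ x in Ioc 0 L, ∫ y, deriv (deriv φ) x * (u t x y * v t x y)) =
        ∫ x in Ioc 0 L, deriv (deriv φ) x * ∫ y, u t x y * v t x y :=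
      setIntegral_congr_fun measurableSet_Ioc fun x _ => integral_const_mul _ _
    have i1 : IntegrableOn (fun x => deriv (deriv φ) x * ∫ y, vorticity (u t) (v t) x y) (Ioc 0 L) :=
      (cφ''.mul cΩ).integrableOn_Ioc
    have i2 : IntegrableOn (fun x => deriv (deriv φ) x * ∫ y, u t x y * v t x y) (Ioc 0 L) :=
      (cφ''.mul cP).integrableOn_Ioc
    rw [e1, e2] at h0
    have e3 : ∫ x in Ioc 0 L, deriv (deriv φ) x * G x =
        (∫ x in Ioc 0 L, deriv (deriv φ) x * ∫ y, u t x y * v t x y) -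
          ν * ∫ x in Ioc 0 L, deriv (deriv φ) x * ∫ y, vorticity (u t) (v t) x y := by
      rw [← integral_const_mul, ← integral_sub i2 (i1.const_mul ν)]
      refine setIntegral_congr_fun measurableSet_Ioc fun x _ => ?_
      simp only [hG]
      ring
    rw [e3]
    linarith
  exact steadyFlux_duBoisReymond_periodic hL cG pG hweak x₁ x₂

end Summit.AnomalousDissipation.AnomalousDissipation.Theorems.StrainedLayerLaw.LogEnstrophyClock

end
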